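import Summits.ResolutionOfSingularities.ResolutionOfSingularities.Theorems.WeightedInvariantContactCylinderDefs
import Summits.ResolutionOfSingularities.ResolutionOfSingularities.Theorems.WeightedInvariantContactCentreFiltrationRegular
import Summits.ResolutionOfSingularities.ResolutionOfSingularities.Theorems.WeightedInvariantIotaOrderEquimultipleCentre
import Summits.ResolutionOfSingularities.ResolutionOfSingularities.Theorems.WeightedInvariantIotaOrderMonomialType
import Summits.ResolutionOfSingularities.ResolutionOfSingularities.Theorems.WeightedInvariantHypersurfaceLocalGameEFT4SDimOneGameRad
import HarnessLib

/-!
# The cylinder construction `jCylinder ι J` EXTENDS the P≤2 pair: the isolated-point branch and consistency with `jContact`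
# (door `HypersurfaceCentreConstruction`, stmt-ResolutionOfSingularities-19897; KEY `stub_localWeightedDropEFT4S`, regime P3;
# res-type-005, res-L1-w43-plan-1 DEALS gen 10 #3 (1) 2026-08-27T10:36:47Z «RESHAPE-LIGHT»)

Topic: `Summits/ResolutionOfSingularities/ResolutionOfSingularities/Theorems`. Helper for the door item
`HypersurfaceCentreConstruction` (stmt-ResolutionOfSingularities-19897, route `WeightedInvariant`), def-free sibling of
`…ContactCylinderDefs` (p524206: `topStratum`, `topStratumPrime`, `cylinderAt`, `jCylinder`).  The dealer's ruling on
(D1): «make the ISOLATED-POINT branch explicit and swappable — keep one `J` and land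
`jCylinder_of_topStratumPrime_eq_maximalIdeal : jCylinder ι J R f m = J R f m` (transport along `R ≃ R_𝔪`, (c5))».  This
file lands it, for EVERY local ring `R`, every `ι` and every iso-invariant `J` (§1), and then proves that the cylinder
construction over the pair of record `(iotaOrd, jContact)` of the rungs P1 ∪ P2 (res-type-092's p514802) RETURNS
`jContact` ITSELF at every position of Krull dimension `≤ 2` (§3):

* §1 `cylinderAt_maximalIdeal`, `jCylinder_of_topStratumPrime_eq_maximalIdeal`, `jCylinder_of_topStratum_eq_closedPoint`
  (isolated top stratum ⇒ the cylinder is `J` read at `R` — the swappable P3b branch), `closedPoint_mem_topStratum`,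
  `topStratumPrime_le_maximalIdeal` (iso-invariant `ι`);
* §2 the top `iotaOrd`-stratum through the closed point of a regular local ring: `= V(g)` at `f = v·gⁿ` of monomial
  type in EVERY dimension (`topStratum_iotaOrd_of_eq_unit_mul_pow`, res-type-025/073), `= {𝔪}` off the monomial type in
  dimension `≤ 2` (`topStratum_iotaOrd_of_not_isMonomialType`, res-type-073's CASE B), inside the primes of height `≥ 2`
  off the monomial type in every dimension (`two_le_height_of_mem_topStratum_iotaOrd`, res-type-078's p524107), `= Spec R`
  at the junk arguments `0` and units;
* §3 `jCylinder_iotaOrd_jContact_of_eq_unit_mul_pow` (EVERY dimension: monomial type ⇒ `jCylinder = (g)^m = jContact`,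
  symbolic powers of the permissible centre `(g)` being ordinary powers, p524107 `comap_map_pow_eq`), the junk cases, and
  the HEADLINE `jCylinder_iotaOrd_jContact_eq_of_ringKrullDim_le_two : jCylinder iotaOrd jContact R f m = jContact R f m`
  for every `f` of a regular local ring of Krull dimension `≤ 2` — so the P3 candidate `jCylinder ι₃ J` with `ι₃ ↾ (dim ≤ 2)
  = iotaOrd`, `J ↾ (dim ≤ 2) = jContact` restricts to the P≤2 rung VERBATIM (nothing proved at dimension `≤ 2` moves).

[OURS · L1 W4.3 · (o28)/(D1b)]  Replaces the role of NO printed item; NOT a statement of the manuscript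
[claim: Hironaka2017, status: under-review]. AI work, weaker than expert review.  Pure commutative algebra over the tree.

## References

* H. Matsumura, Commutative Ring Theory (1987), §4 (localisation at a prime), Thm. 19.3 (Serre: `R_𝔭` regular),
  Thm. 20.3 (regular local rings are UFDs). [Matsumura1987]
* O. Zariski, P. Samuel, Commutative Algebra II, Ch. VIII §1 (the order valuation of a regular local ring). [ZariskiSamuel1960]
* res-L1-w43-plan-1, `CRUX-PLAN.md` §v7.2 (rung ladder P1/P2/P3), DEALS gen 10 #3 (OURS, AI planning).
-/

noncomputable section

open IsLocalRing Literature.AlgebraicGeometry.Resolution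
open Summit.ResolutionOfSingularities.ResolutionOfSingularities.Cruxes.HypersurfaceCentreConstruction.LocalEngine

set_option linter.dupNamespace false -- mandated namespace of this single-conjunct summit

namespace Summit.ResolutionOfSingularities.ResolutionOfSingularities.Theorems

namespace ContactCylinder

/-! ## §1 The isolated-point branch (any local ring, any `ι`, any iso-invariant `J`) -/

section Isolated

variable {R : Type} [CommRing R]

/-- For a local ring `R` the structure map `R → R_𝔪` is bijective (the complement of `𝔪` consists of units;
Mathlib's `IsLocalization.atUnits`). [folklore] -/
theorem algebraMap_atPrime_maximalIdeal_bijective (R : Type) [CommRing R] [IsLocalRing R] :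
    Function.Bijective (algebraMap R (Localization.AtPrime (maximalIdeal R))) := by
  have hunits : (maximalIdeal R).primeCompl ≤ IsUnit.submonoid R := by
    intro x hx
    rw [IsUnit.mem_submonoid_iff]
    by_contra hnu
    exact hx ((IsLocalRing.mem_maximalIdeal x).mpr (mem_nonunits_iff.mpr hnu))
  let e : R ≃ₐ[R] Localization.AtPrime (maximalIdeal R) :=
    IsLocalization.atUnits R (maximalIdeal R).primeCompl hunits
  have he : (e : R → Localization.AtPrime (maximalIdeal R)) =
      algebraMap R (Localization.AtPrime (maximalIdeal R)) := funext fun x => by simpa using e.commutes x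
  rw [← he]
  exact e.bijective

/-- **The cylinder over the closed point is `J` itself**: `cylinderAt J R 𝔪 f m = (J (R_𝔪) (f/1) m) ∩ R = J R f m` for an
iso-invariant `J` ((c5) `JIsoInvariant`, transport along `R ≃ R_𝔪`). [folklore] -/
theorem cylinderAt_maximalIdeal {J : (R : Type) → [CommRing R] → R → ℕ → Ideal R} (hJ : JIsoInvariant J)
    (R : Type) [CommRing R] [IsLocalRing R] (f : R) (m : ℕ) :
    cylinderAt J R (maximalIdeal R) f m = J R f m := by
  rw [cylinderAt_def, LocalGameEFT4SDimOneRad.J_localization_maximalIdeal_eq_of_isoInvariant J hJ f m]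
  exact Ideal.comap_map_of_bijective _ (algebraMap_atPrime_maximalIdeal_bijective R)

/-- Cylinders over equal primes agree (the prime enters `cylinderAt` through an instance argument). [folklore] -/
theorem cylinderAt_congr (J : (R : Type) → [CommRing R] → R → ℕ → Ideal R) (R : Type) [CommRing R]
    {P Q : Ideal R} [P.IsPrime] [Q.IsPrime] (h : P = Q) (f : R) (m : ℕ) :
    cylinderAt J R P f m = cylinderAt J R Q f m := by
  subst h
  rfl

/-- **RESHAPE-LIGHT (res-L1-w43-plan-1 DEALS gen 10 #3 (1)): the isolated-point branch of the cylinder construction.**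
When the generic prime of the top `ι`-stratum through the closed point IS the closed point (`topStratumPrime ι R f = 𝔪`,
regime P3b at Krull dimension `≥ 3`, CASE B at dimension `≤ 2`), `jCylinder ι J R f m = J R f m` for every iso-invariant
`J` — the cylinder rule reads `J` at the position itself, so the P3b branch is swappable by changing `J` there only.
[OURS · L1 W4.3 · (D1b)] -/
theorem jCylinder_of_topStratumPrime_eq_maximalIdeal (ι : (R : Type) → [CommRing R] → R → Ordinal.{0})
    {J : (R : Type) → [CommRing R] → R → ℕ → Ideal R} (hJ : JIsoInvariant J) (R : Type) [CommRing R]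
    [IsLocalRing R] (f : R) (m : ℕ) (h : topStratumPrime ι R f = maximalIdeal R) :
    jCylinder ι J R f m = J R f m := by
  haveI : (topStratumPrime ι R f).IsPrime := by
    rw [h]
    infer_instance
  rw [jCylinder_eq_cylinderAt, cylinderAt_congr J R h, cylinderAt_maximalIdeal hJ]

/-- When the top `ι`-stratum is the closed point alone, its generic prime is `𝔪`. [folklore] -/
theorem topStratumPrime_eq_maximalIdeal_of_topStratum_eq (ι : (R : Type) → [CommRing R] → R → Ordinal.{0})
    (R : Type) [CommRing R] [IsLocalRing R] (f : R)
    (hE : topStratum ι R f = {𝔮 | maximalIdeal R ≤ 𝔮.asIdeal}) :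
    topStratumPrime ι R f = maximalIdeal R :=
  topStratumPrime_eq_of_topStratum_eq ι R f hE

/-- **Isolated top stratum ⇒ the cylinder is `J` read at the position**: if `topStratum ι R f = {𝔪}` then
`jCylinder ι J R f m = J R f m` (iso-invariant `J`). [OURS · L1 W4.3 · (D1b)] -/
theorem jCylinder_of_topStratum_eq_closedPoint (ι : (R : Type) → [CommRing R] → R → Ordinal.{0})
    {J : (R : Type) → [CommRing R] → R → ℕ → Ideal R} (hJ : JIsoInvariant J) (R : Type) [CommRing R]
    [IsLocalRing R] (f : R) (m : ℕ) (hE : topStratum ι R f = {𝔮 | maximalIdeal R ≤ 𝔮.asIdeal}) :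
    jCylinder ι J R f m = J R f m :=
  jCylinder_of_topStratumPrime_eq_maximalIdeal ι hJ R f m (topStratumPrime_eq_maximalIdeal_of_topStratum_eq ι R f hE)

/-- The closed point lies on the top `ι`-stratum for every iso-invariant `ι` ((c6): `ι (R_𝔪) (f/1) = ι R f` along
`R ≃ R_𝔪`). [folklore] -/
theorem closedPoint_mem_topStratum {ι : (R : Type) → [CommRing R] → R → Ordinal.{0}} (hι : IotaIsoInvariant ι)
    (R : Type) [CommRing R] [IsLocalRing R] (f : R) : IsLocalRing.closedPoint R ∈ topStratum ι R f :=
  LocalGameEFT4SDimOne.iota_localization_maximalIdeal_eq ι hι f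

/-- Hence the generic prime of the top stratum lies in `𝔪` (iso-invariant `ι`). [folklore] -/
theorem topStratumPrime_le_maximalIdeal {ι : (R : Type) → [CommRing R] → R → Ordinal.{0}} (hι : IotaIsoInvariant ι)
    (R : Type) [CommRing R] [IsLocalRing R] (f : R) : topStratumPrime ι R f ≤ maximalIdeal R :=
  topStratumPrime_le ι R f (closedPoint_mem_topStratum hι R f)

/-- When the top stratum is all of `Spec R` (junk arguments: `0`, units) and `R` is a domain, its generic prime is `⊥`.
[folklore] -/
theorem topStratumPrime_eq_bot_of_topStratum_eq_univ (ι : (R : Type) → [CommRing R] → R → Ordinal.{0})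
    (R : Type) [CommRing R] [IsDomain R] (f : R) (hE : topStratum ι R f = Set.univ) :
    topStratumPrime ι R f = ⊥ :=
  topStratumPrime_eq_of_topStratum_eq ι R f (P := ⊥) (by rw [hE]; ext 𝔮; simp)

/-- … and the cylinder is `J` read at the generic point `R_{(0)}` (the fraction field), contracted to `R`. [folklore] -/
theorem jCylinder_of_topStratum_eq_univ (ι : (R : Type) → [CommRing R] → R → Ordinal.{0})
    (J : (R : Type) → [CommRing R] → R → ℕ → Ideal R) (R : Type) [CommRing R] [IsDomain R] (f : R) (m : ℕ)
    (hE : topStratum ι R f = Set.univ) :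
    jCylinder ι J R f m =
      (J (Localization.AtPrime (⊥ : Ideal R)) (algebraMap R (Localization.AtPrime (⊥ : Ideal R)) f) m).comap
        (algebraMap R (Localization.AtPrime (⊥ : Ideal R))) :=
  jCylinder_eq_of_topStratum_eq ι J R f m (P := ⊥) (by rw [hE]; ext 𝔮; simp)

end Isolated

/-! ## §2 The top `iotaOrd`-stratum of a regular local ring -/

section OrderStratum

variable {R : Type} [CommRing R]

/-- Off `V(f)` the order vanishes: `f ∉ 𝔮 ⇒ iotaOrd (R_𝔮) (f/1) = 0` (`f/1` is a unit). [folklore] -/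
theorem iotaOrd_localization_eq_zero_of_not_mem (𝔮 : Ideal R) [𝔮.IsPrime] {f : R} (hf : f ∉ 𝔮) :
    iotaOrd (Localization.AtPrime 𝔮) (algebraMap R (Localization.AtPrime 𝔮) f) = 0 := by
  have hu : IsUnit (algebraMap R (Localization.AtPrime 𝔮) f) :=
    IsLocalization.map_units (Localization.AtPrime 𝔮) (⟨f, hf⟩ : 𝔮.primeCompl)
  rw [iotaOrd_eq_ordOfENat_adicOrder, adicOrder_of_isUnit hu]
  simpa using ordOfENat_natCast 0

/-- A unit has order `0` (local ring). [folklore] -/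
theorem iotaOrd_eq_zero_of_isUnit (R : Type) [CommRing R] [IsLocalRing R] {f : R} (hf : IsUnit f) :
    iotaOrd R f = 0 := by
  rw [iotaOrd_eq_ordOfENat_adicOrder, adicOrder_of_isUnit hf]
  simpa using ordOfENat_natCast 0

/-- An element of `𝔪` has order `≠ 0` (local ring). [folklore] -/
theorem iotaOrd_ne_zero_of_mem_maximalIdeal (R : Type) [CommRing R] [IsLocalRing R] {f : R}
    (hf : f ∈ maximalIdeal R) : iotaOrd R f ≠ 0 := by
  have h1 : ((1 : ℕ) : Ordinal) ≤ iotaOrd R f := (natCast_le_iotaOrd_iff R f 1).mpr (by rwa [pow_one])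
  rw [Nat.cast_one] at h1
  exact Order.one_le_iff_ne_zero.mp h1

/-- A prime on the top `iotaOrd`-stratum of `f ∈ 𝔪` contains `f`. [folklore] -/
theorem mem_of_mem_topStratum_iotaOrd [IsLocalRing R] {f : R} (hf : f ∈ maximalIdeal R) {𝔮 : PrimeSpectrum R}
    (h𝔮 : 𝔮 ∈ topStratum iotaOrd R f) : f ∈ 𝔮.asIdeal := by
  by_contra hf𝔮
  rw [mem_topStratum_iff, iotaOrd_localization_eq_zero_of_not_mem 𝔮.asIdeal hf𝔮] at h𝔮
  exact iotaOrd_ne_zero_of_mem_maximalIdeal R hf h𝔮.symm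

/-- **Monomial type, EVERY dimension: the top order stratum is `V(g)`.**  For `f = v·gⁿ` (`v` a unit, `g ∈ 𝔪 ∖ 𝔪²`,
`n ≥ 1`) in a regular local ring, `iotaOrd (R_𝔮) f = iotaOrd R f (= n)` exactly at the primes `𝔮 ∋ g` (res-type-025's
`iotaOrd_localization_of_eq_unit_mul_pow`; off `V(g) = V(f)` the order is `0`). [OURS · L1 W4.3, kernel] -/
theorem topStratum_iotaOrd_of_eq_unit_mul_pow [IsRegularLocalRing R] {v g f : R} (hv : IsUnit v)
    (hg : g ∈ maximalIdeal R) (hg2 : g ∉ maximalIdeal R ^ 2) {n : ℕ} (hn : 0 < n) (hf : f = v * g ^ n) :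
    topStratum iotaOrd R f = {𝔮 | Ideal.span {g} ≤ 𝔮.asIdeal} := by
  ext 𝔮
  rw [mem_topStratum_iff, Set.mem_setOf_eq, Ideal.span_singleton_le_iff_mem,
    IotaOrderStrat.iotaOrd_eq_natCast_of_eq_unit_mul_pow hv hg hg2 hf]
  by_cases hg𝔮 : g ∈ 𝔮.asIdeal
  · rw [IotaOrderStrat.iotaOrd_localization_of_eq_unit_mul_pow hv hg hg2 hf 𝔮.asIdeal hg𝔮]
    exact iff_of_true rfl hg𝔮
  · have hf𝔮 : f ∉ 𝔮.asIdeal := fun h =>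
      hg𝔮 (IotaOrderStrat.mem_of_eq_unit_mul_pow_of_mem hv hf 𝔮.asIdeal h)
    rw [iotaOrd_localization_eq_zero_of_not_mem 𝔮.asIdeal hf𝔮]
    refine iff_of_false (fun h => ?_) hg𝔮
    have h0 : (n : Ordinal) = 0 := h.symm
    exact hn.ne' (by exact_mod_cast h0)

/-- **Off the monomial type, Krull dimension `≤ 2`: the top order stratum is the closed point alone** (res-type-073's
CASE B `strat_maximalIdeal_of_forall_ne` on `V(f)`; order `0` off `V(f)`). [OURS · L1 W4.3, kernel] -/
theorem topStratum_iotaOrd_of_not_isMonomialType [IsRegularLocalRing R] (hdim : ringKrullDim R ≤ 2) {f : R}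
    (hf0 : f ≠ 0) (hf : f ∈ maximalIdeal R) (hnm : ¬ IsMonomialType f) :
    topStratum iotaOrd R f = {𝔮 | maximalIdeal R ≤ 𝔮.asIdeal} := by
  have hB : ∀ (v g : R) (n : ℕ), IsUnit v → g ∈ maximalIdeal R → g ∉ maximalIdeal R ^ 2 → f ≠ v * g ^ n :=
    fun v g n hv hg hg2 hfe => hnm ⟨v, g, n, hv, hg, hg2, hfe⟩
  obtain ⟨-, -, -, hstrat⟩ := IotaOrderStrat.strat_maximalIdeal_of_forall_ne hdim hf0 hf hB
  ext 𝔮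
  rw [Set.mem_setOf_eq]
  by_cases hf𝔮 : f ∈ 𝔮.asIdeal
  · rw [mem_topStratum_iff]
    exact hstrat 𝔮.asIdeal hf𝔮
  · exact iff_of_false (fun h => hf𝔮 (mem_of_mem_topStratum_iotaOrd hf h)) fun hle => hf𝔮 (hle hf)

/-- **Off the monomial type, EVERY dimension: the top order stratum lies inside the primes of height `≥ 2`**
(res-type-078's `two_le_height_of_iotaOrd_localization_eq`, p524107).  At a position of Krull dimension `3` the stratum
therefore consists of `𝔪` and height-two primes only — the case split every `ι₃` design starts from.
[OURS · L1 W4.3, kernel] -/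
theorem two_le_height_of_mem_topStratum_iotaOrd [IsRegularLocalRing R] {f : R} (hf0 : f ≠ 0)
    (hf : f ∈ maximalIdeal R) (hnm : ¬ IsMonomialType f) {𝔮 : PrimeSpectrum R}
    (h𝔮 : 𝔮 ∈ topStratum iotaOrd R f) : 2 ≤ 𝔮.asIdeal.height :=
  EquimultipleCentre.two_le_height_of_iotaOrd_localization_eq hf0 hnm 𝔮.asIdeal
    (mem_of_mem_topStratum_iotaOrd hf h𝔮) h𝔮

/-- Junk argument `0`: the order is `ω` everywhere, the top stratum is `Spec R` (local `R`). [folklore] -/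
theorem topStratum_iotaOrd_zero (R : Type) [CommRing R] [IsLocalRing R] : topStratum iotaOrd R 0 = Set.univ := by
  refine Set.eq_univ_of_forall fun 𝔮 => ?_
  rw [mem_topStratum_iff, map_zero, (iotaOrd_eq_omega0_iff _ _).mpr fun n => Ideal.zero_mem _,
    (iotaOrd_eq_omega0_iff R 0).mpr fun n => Ideal.zero_mem _]

/-- Junk argument a unit: the order is `0` everywhere, the top stratum is `Spec R` (local `R`). [folklore] -/
theorem topStratum_iotaOrd_of_isUnit (R : Type) [CommRing R] [IsLocalRing R] {f : R} (hf : IsUnit f) :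
    topStratum iotaOrd R f = Set.univ := by
  refine Set.eq_univ_of_forall fun 𝔮 => ?_
  rw [mem_topStratum_iff, iotaOrd_eq_zero_of_isUnit _ (hf.map _), iotaOrd_eq_zero_of_isUnit R hf]

end OrderStratum

/-! ## §3 Consistency: over `(iotaOrd, jContact)` the cylinder construction returns `jContact` at Krull dimension `≤ 2` -/

section Consistency

variable {R : Type} [CommRing R]

/-- **Monomial type, EVERY dimension: `jCylinder iotaOrd jContact R f m = jContact R f m = (g)^m`.**  For `f = v·gⁿ`
(`v` a unit, `g` a regular parameter, `n ≥ 1`) of a regular local ring `R`: the top order stratum is `V(g)`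
(`topStratum_iotaOrd_of_eq_unit_mul_pow`), so the cylinder reads `jContact` in `R_{(g)}` — a discrete valuation ring in
which `f/1 = (v/1)·(g/1)ⁿ` is again of monomial type (res-type-025), value `(g/1)^m` (res-type-092's
`jContact_of_eq_unit_mul_pow`) — and contracts to `(g)^m R_{(g)} ∩ R = (g)^m` because the powers of the permissible
centre `(g)` are primary (res-type-078's `comap_map_pow_eq`). [OURS · L1 W4.3 · (D1b)] -/
theorem jCylinder_iotaOrd_jContact_of_eq_unit_mul_pow [IsRegularLocalRing R] {v g f : R} (hv : IsUnit v)
    (hg : g ∈ maximalIdeal R) (hg2 : g ∉ maximalIdeal R ^ 2) {n : ℕ} (hn : 0 < n) (hf : f = v * g ^ n) (m : ℕ) :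
    jCylinder iotaOrd jContact R f m = jContact R f m := by
  obtain ⟨hprime, hreg, -, -⟩ := IotaOrderStrat.strat_of_eq_unit_mul_pow hv hg hg2 hn hf
  haveI := hprime
  haveI := hreg
  rw [jCylinder_eq_of_topStratum_eq iotaOrd jContact R f m (topStratum_iotaOrd_of_eq_unit_mul_pow hv hg hg2 hn hf)]
  haveI : IsRegularLocalRing (Localization.AtPrime (Ideal.span {g})) :=
    isRegularLocalRing_localization_atPrime R (Ideal.span {g})
  obtain ⟨v', hv', hg', hg2', hf'⟩ := IotaOrderStrat.exists_eq_unit_mul_pow_localization hv hg hg2 hf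
    (Ideal.span {g}) (Ideal.mem_span_singleton_self g)
  rw [hf', jContact_of_eq_unit_mul_pow (Localization.AtPrime (Ideal.span {g})) hv' hg' hg2' hn m, hf,
    jContact_of_eq_unit_mul_pow R hv hg hg2 hn m,
    show Ideal.span {algebraMap R (Localization.AtPrime (Ideal.span {g})) g} =
        (Ideal.span {g}).map (algebraMap R (Localization.AtPrime (Ideal.span {g}))) by
      rw [Ideal.map_span, Set.image_singleton],
    ← Ideal.map_pow]
  exact EquimultipleCentre.comap_map_pow_eq (Ideal.span {g}) (Ideal.span {g}) le_rfl m

/-- Junk argument `0` (local domain `R`): both sides are `⊥` — the cylinder reads `jContact (Frac R) 0 m = ⊥` and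
`R → Frac R` is injective. [folklore] -/
theorem jCylinder_iotaOrd_jContact_zero (R : Type) [CommRing R] [IsLocalRing R] [IsDomain R] (m : ℕ) :
    jCylinder iotaOrd jContact R 0 m = jContact R 0 m := by
  rw [jCylinder_of_topStratum_eq_univ iotaOrd jContact R 0 m (topStratum_iotaOrd_zero R), map_zero, jContact_eq,
    jContactLocal_zero, jContact_eq, jContactLocal_zero]
  exact Ideal.comap_bot_of_injective _
    (IsLocalization.injective (Localization.AtPrime (⊥ : Ideal R)) (⊥ : Ideal R).primeCompl_le_nonZeroDivisors)

/-- Junk argument a unit (local domain `R`): both sides are `⊤`. [folklore] -/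
theorem jCylinder_iotaOrd_jContact_of_isUnit (R : Type) [CommRing R] [IsLocalRing R] [IsDomain R] {f : R}
    (hf : IsUnit f) (m : ℕ) : jCylinder iotaOrd jContact R f m = jContact R f m := by
  rw [jCylinder_of_topStratum_eq_univ iotaOrd jContact R f m (topStratum_iotaOrd_of_isUnit R hf), jContact_eq,
    jContactLocal_of_isUnit (hf.map _), Ideal.comap_top, jContact_eq, jContactLocal_of_isUnit hf]

/-- **Off the monomial type, Krull dimension `≤ 2`: `jCylinder iotaOrd jContact R f m = jContact R f m`** — the top order
stratum is `{𝔪}` (CASE B), so the isolated-point branch `jCylinder_of_topStratum_eq_closedPoint` applies with (c6-J)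
`jContact_isoInvariant`. [OURS · L1 W4.3 · (D1b)] -/
theorem jCylinder_iotaOrd_jContact_of_not_isMonomialType [IsRegularLocalRing R] (hdim : ringKrullDim R ≤ 2) {f : R}
    (hf0 : f ≠ 0) (hf : f ∈ maximalIdeal R) (hnm : ¬ IsMonomialType f) (m : ℕ) :
    jCylinder iotaOrd jContact R f m = jContact R f m :=
  jCylinder_of_topStratum_eq_closedPoint iotaOrd jContact_isoInvariant R f m
    (topStratum_iotaOrd_of_not_isMonomialType hdim hf0 hf hnm)

/-- **HEADLINE (D1b).  At every position of Krull dimension `≤ 2` the cylinder construction over the P≤2 pair returns the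
P≤2 centre filtration: `jCylinder iotaOrd jContact R f m = jContact R f m`** for EVERY `f` of a regular local ring `R` with
`ringKrullDim R ≤ 2` and every `m` (`0 ↦ ⊥` and units `↦ ⊤` through the generic point `(0)`; monomial type through `V(g)`;
the contact branch through `{𝔪}`).  Consequently a P3 pair `(ι₃, jCylinder ι₃ J₃)` whose letters restrict to
`(iotaOrd, jContact)` in dimension `≤ 2` restricts to the rung of record (p521487 `stub_keyRung_dimLETwo`) verbatim.
[OURS · L1 W4.3 · (D1b)] -/
theorem jCylinder_iotaOrd_jContact_eq_of_ringKrullDim_le_two (R : Type) [CommRing R] [IsRegularLocalRing R]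
    (hdim : ringKrullDim R ≤ 2) (f : R) (m : ℕ) : jCylinder iotaOrd jContact R f m = jContact R f m := by
  haveI := isDomain_of_isRegularLocalRing R
  by_cases hf0 : f = 0
  · subst hf0
    exact jCylinder_iotaOrd_jContact_zero R m
  by_cases hfu : IsUnit f
  · exact jCylinder_iotaOrd_jContact_of_isUnit R hfu m
  have hf : f ∈ maximalIdeal R := (IsLocalRing.mem_maximalIdeal f).mpr (mem_nonunits_iff.mpr hfu)
  by_cases hmono : IsMonomialType f
  · obtain ⟨v, g, n, hv, hg, hg2, hfe⟩ := hmono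
    have hn : 0 < n := by
      rcases Nat.eq_zero_or_pos n with h | h
      · exfalso
        rw [h, pow_zero, mul_one] at hfe
        exact hfu (hfe ▸ hv)
      · exact h
    exact jCylinder_iotaOrd_jContact_of_eq_unit_mul_pow hv hg hg2 hn hfe m
  · exact jCylinder_iotaOrd_jContact_of_not_isMonomialType hdim hf0 hf hmono m

end Consistency

end ContactCylinder

end Summit.ResolutionOfSingularities.ResolutionOfSingularities.Theorems

end
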